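import Mathlib
import Literature.NumberTheory.Sieve.Maynard2016Lemma7MainSumLink
import Literature.NumberTheory.Sieve.Maynard2016CoupledBoxWSlot
import HarnessLib

/-!
# Maynard (2016), Lemma 7: the main term `S_i` as `φ`-weighted coupled sums on the `k − 1` free slots

Topic `Literature/NumberTheory/Sieve`; trunk AntSieve / parity (Maynard 2016 large-gaps ladder, named
fact `Literature.NumberTheory.Sieve.Maynard2016.Lemma7Tuple` of `Maynard2016Lemma7PerTuple.lean`).

J. Maynard, *Large gaps between primes*, Ann. of Math. (2) 183 (2016), 915–933 = arXiv:1408.5110,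
§6, proof of Lemma 7, display (6.32) ("By an argument analogous to that of Lemma 6 …").  Combining
`Maynard2016Lemma7MainSumLink.ofReal_solvSum_eq_sum` (the expansion of `S_i`) with the trivial-slot
re-indexing of `Maynard2016CoupledBoxWSlot`:
**`S_i = Σ_j Σ_{j'} c_j c_{j'} · F_{i,j}(0) F_{i,j'}(0) G(0)² ·
  coupledLcmSumW (1/φ) (P_w) m (restrictPairs i i (couplingSet7 p₀ i)) (F_{·,j}) (F_{·,j'}) G G x y x`**,
a combination of the `φ`-weighted coupled sums of `Maynard2016CoupledBoxW` over the index type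
`{l : Fin k // l ≠ i}` (the `k − 1` non-trivial slots on each side), to which the kernel representation
`LcmEuler.coupledLcmSumW_eq_integral_freqKernel` and the weighted engine
(`Maynard2016CoupledKernelW` … `Maynard2016CoupledProductW`, `Maynard2016CoupledBoxWPolylog`) apply with
`w = phiInv` (`isLcmWeight_phiInv`, `norm_phiInv_le_one`).

## References

* J. Maynard, *Large gaps between primes*, Ann. of Math. (2) 183 (2016), 915–933; arXiv:1408.5110,
  §6, displays (6.26), (6.32). [Maynard2016LargeGaps]
-/

noncomputable section

open Filter Finset
open scoped BigOperators Topology ArithmeticFunction.Moebius Classical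

namespace Literature.NumberTheory.Sieve

namespace Maynard2016

open LcmEuler

variable {k J : ℕ}

/-- The restricted box of slot `i` is the box `[1,X]^k` filtered by `d_i = 1`. [folklore] -/
private theorem rbox_eq_filter (k X : ℕ) (i : Fin k) :
    rbox k X i = (lcmBox (Fin k) X).filter (fun d => d i = 1) := rfl

/-- **The inner sum of `S_i` on the free slots**: for `1 ≤ x`,
`Σ_{(d,d',e,e') ∈ rbox⁴} [CoupledAdm (P_w) m M (d,d') (e,e')] · T_{F,F',G,G'}(d,d',e,e')
 = F_i(0) F'_i(0) G_i(0) G'_i(0) · coupledLcmSumW w (P_w) m (restrictPairs i i M) (F|) (F'|) (G|) (G'|) x y x`.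
[cite: Maynard2016LargeGaps, §6 displays (6.26), (6.32)] -/
theorem sum_rbox_coupledLcmTermW_eq (w : ℕ → ℂ) (W m : ℕ) (M : ℕ → Finset (Fin k × Fin k))
    (F F' G G' : Fin k → ℝ → ℝ) (xr yr : ℝ) {x : ℕ} (hx : 1 ≤ x) (i : Fin k) :
    ∑ d ∈ rbox k x i, ∑ d' ∈ rbox k x i, ∑ e ∈ rbox k x i, ∑ e' ∈ rbox k x i,
        (if CoupledAdm W m M (d, d') (e, e') then coupledLcmTermW w F F' G G' xr yr (d, d') (e, e')
          else 0) =
      (F i 0 : ℂ) * F' i 0 * G i 0 * G' i 0 *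
        coupledLcmSumW w W m (restrictPairs i i M) (fun l => F l.1) (fun l => F' l.1)
          (fun l => G l.1) (fun l => G' l.1) xr yr x := by
  rw [rbox_eq_filter]
  simp_rw [sum_filter_lcmBox_eq_sum_extOne i hx, coupledAdm_extOne_iff, coupledLcmTermW_extOne]
  rw [coupledLcmSumW, Finset.mul_sum]
  simp_rw [Finset.sum_product, mul_ite, mul_zero]

/-- **Lemma 7's main term on the free slots**: for large `x` (`1 ≤ x < p₀` prime, `(m p₀ − 1, P_y) = 1`,
prime factors of the `h_b − h_a` divide `P_w`),
`S_i = Σ_j Σ_{j'} c_j c_{j'} · (F_{i,j}(0) F_{i,j'}(0) G(0) G(0)) ·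
  coupledLcmSumW phiInv (P_w) m (restrictPairs i i (couplingSet7 p₀ i)) (F_{·,j}|) (F_{·,j'}|) G G x y x`
— the `φ`-weighted coupled sums over the `k − 1` non-trivial slots.
[cite: Maynard2016LargeGaps, §6 display (6.32)] -/
theorem ofReal_solvSum_eq_coupledLcmSumW {c : Fin J → ℝ} {Fd : Fin k → Fin J → ℝ → ℝ} {G : ℝ → ℝ}
    (hD : IsSieveData k J c Fd G) {ε : ℝ} {x : ℕ} (hx1 : 1 ≤ x) (hlogx : 0 < Real.log x)
    (hlogy : 0 < Real.log (y ε x)) {m p₀ : ℕ} (hp₀ : p₀.Prime) (hm : 1 ≤ m) (hxp : x < p₀)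
    (hcop : Nat.Coprime (m * p₀ - 1) (primorial ⌊y ε x⌋₊))
    (hW : ∀ a b : Fin k, a ≠ b → ∀ p : ℕ, p.Prime →
      (p : ℤ) ∣ (hTuple k x b : ℤ) - hTuple k x a → p ∣ Pw x) (i : Fin k) :
    ((solvSum c Fd G ε x m p₀ i : ℝ) : ℂ) =
      ∑ j, ∑ j', (c j : ℂ) * c j' *
        ((Fd i j 0 : ℂ) * Fd i j' 0 * G 0 * G 0 *
          coupledLcmSumW phiInv (Pw x) m (restrictPairs i i (couplingSet7 k x m p₀ i))
            (fun l : {l : Fin k // l ≠ i} => Fd l.1 j) (fun l => Fd l.1 j') (fun _ => G) (fun _ => G)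
            (x : ℝ) (y ε x) x) := by
  rw [ofReal_solvSum_eq_sum hD hx1 hlogx hlogy hp₀ hm hxp hcop hW i]
  refine Finset.sum_congr rfl fun j _ => Finset.sum_congr rfl fun j' _ => ?_
  rw [sum_rbox_coupledLcmTermW_eq phiInv (Pw x) m (couplingSet7 k x m p₀ i) (fun l => Fd l j)
    (fun l => Fd l j') (fun _ => G) (fun _ => G) (x : ℝ) (y ε x) hx1 i]

end Maynard2016

end Literature.NumberTheory.Sieve

end
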